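import Summits.QuantumFields.YangMills.Theorems.PoincareLipschitzTwoSidedOfConcentrationStep
import HarnessLib

/-!
# Route `PoincareLipschitz` ∕ LINE 27 «MedianCentring» (planner ym-r3-idea-2 g15, crux `RevelationMartingale.MeanDeviationShallowL`,
# stmt-QuantumFields-23133; registered skeleton `Cruxes/HistoryTailL/Lines/median_centring.lean`, stub (T) `stub_localTailOfMedian`) —
# helper T-1: THE ONE-HEIGHT STEP CENTRED AT THE MEDIAN

This is the landed one-height step `PoincareLipschitz.TwoSidedOfConcentration.local_step` (McShane extension + concentration ⇒
the local window tail at level `j`) with the MEAN hypothesis `E f_a ≤ θ/2` (the `MeanDeviationL` face) replaced by the 3/4-QUANTILE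
hypothesis `Gibbs_K{f_a ≤ θ/8} ≥ 3/4`, the positivity `0 < cc` of the concentration rate and one more `γ`-smallness row
`136(CL+1)·√(log(2Cc+2)/cc) ≤ p(g_{K−j})`.  The statement is the ideator's free-hands handle VERBATIM
(HOME `ideators/ym-r3-idea-2/g15/LINE27-T-first-lemma-local_step_median.lean`, sha16 cbc5e45a2424593d).

Proof.  Let `g` be the capped McShane extension of `f_a|_G` of `local_step` (`0 ≤ g ≤ θ`, `g ≤ f_a` on `G`, `g = θ` on
`G ∩ {θ ≤ f_a}`, measurable, gauge invariant, box-local, `Λ`-Lipschitz with `Λ = (CL+1)/√(L^j)`, box side `n = 17L^j`).  Since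
`g ≤ f_a` on `G`, `{f_a ≤ θ/8} ⊆ {g ≤ θ/8} ∪ Gᶜ`, so `Gibbs_K{g ≤ θ/8} ≥ 3/4 − 1/4 = 1/2`.  If `E g > θ/8`, the concentration
hypothesis applied to the admissible observable `−g` at radius `r₀ = E g − θ/8 > 0` gives `1/2 ≤ Cc·exp(−cc β_K r₀²/(n²Λ²))`, whence
`cc β_K r₀² ≤ n²Λ²·log(2Cc+2) = 289(CL+1)² L^j log(2Cc+2)`; with `β_K θ² = L^j p²` (`beta_mul_θBal_sq`) this is
`r₀ ≤ 17(CL+1)√(log(2Cc+2)/cc)·θ/p ≤ θ/8` by the smallness row, so `E g ≤ θ/4` in all cases («the concentration inequality converts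
a median into a mean», Ledoux 2001 Prop. 1.7–1.8).  The rest is `local_step` verbatim: the event lies in `{θ/4 ≤ g − E g}` and the
concentration bound at `r = θ/4` has exponent `cc·p²/(4624(CL+1)²)`.

Width seat ym3-torus-px10 g6 (cell ym3-torus, WIDTH COPY «width 10»; free-hands handle of ideator ym-r3-idea-2 g15 2026-08-29T13:26:11Z),
`--supports stmt-QuantumFields-23133`.  A conditional step over hypotheses: no stub, crux, rung (R3 = YM₃ on T³ is a RECORD rung; NOT d = 4,
NOT infinite volume, NOT a mass gap, NOT Clay) or summit is proved; the Yang–Mills mass gap is NOT proved.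
-/

set_option autoImplicit false

namespace Summit.QuantumFields.YangMills.Theorems.PoincareLipschitz.MedianCentring

open MeasureTheory
open scoped BigOperators
open Literature.MathematicalPhysics.QuantumFieldTheory.Balaban1983to89
open Literature.MathematicalPhysics.QuantumFieldTheory.Balaban1983to89.T3ContinuumYM3Torus
open Literature.MathematicalPhysics.QuantumFieldTheory.Balaban1983to89.T3UnitScaleTilt
open Literature.MathematicalPhysics.QuantumFieldTheory.Balaban1983to89.T3UnitLawDensityEML (ℰp measurableE_ℰp)
open Literature.MathematicalPhysics.QuantumFieldTheory.Balaban1983to89.T3OrbitAverage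
open Literature.MathematicalPhysics.QuantumFieldTheory.Balaban1983to89.T3MinimiserStabilityReduction (θBal_pos)
open Literature.MathematicalPhysics.QuantumFieldTheory.Balaban1983to89.T3FinestHeightTail (beta_mul_θBal_sq)
open Literature.MathematicalPhysics.QuantumFieldTheory.Balaban1983to89.T4PairDerivBridge (dist1_le_two_specialUnitaryGroup)
open Summit.QuantumFields.YangMills.Theorems.PoincareLipschitz.TwoSidedOfConcentration

/-- **A lower bound on a sub-Gaussian tail pins the exponent.**  If `0 ≤ X` and `1/2 ≤ Cc·exp(−X)` then `X ≤ log(2Cc + 2)`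
(indeed `exp X ≤ 2Cc`).  [folklore] -/
theorem exponent_le_log_of_half_le {Cc X : ℝ} (hX : 0 ≤ X) (h : 1 / 2 ≤ Cc * Real.exp (-X)) :
    X ≤ Real.log (2 * Cc + 2) := by
  have hexp : 0 < Real.exp (-X) := Real.exp_pos _
  have hCc : 0 < Cc := by
    by_contra hCc
    push Not at hCc
    have : Cc * Real.exp (-X) ≤ 0 := mul_nonpos_of_nonpos_of_nonneg hCc hexp.le
    linarith
  have h2 : Real.exp X ≤ 2 * Cc := by
    have hmul := mul_le_mul_of_nonneg_right h (Real.exp_pos X).le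
    rw [mul_assoc, ← Real.exp_add, neg_add_cancel, Real.exp_zero, mul_one] at hmul
    linarith
  have _ := hX
  calc X = Real.log (Real.exp X) := (Real.log_exp X).symm
    _ ≤ Real.log (2 * Cc) := Real.log_le_log (Real.exp_pos X) h2
    _ ≤ Real.log (2 * Cc + 2) := Real.log_le_log (by positivity) (by linarith)

/-- **The centring radius is at most `θ/8`.**  Pure real arithmetic of the median-to-mean step: from
`cc·β·r₀² ≤ ℓ·D`, `D = 289(CL+1)²·L^j`, `β·θ² = L^j·p²` and the smallness row `136(CL+1)·√(ℓ/cc) ≤ p` (all quantities positive)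
it follows that `r₀ ≤ θ/8`.  [folklore] -/
theorem centring_radius_le {cc β r₀ θ CL Lj D ℓ p : ℝ} (hcc : 0 < cc) (hβ : 0 < β) (hr₀ : 0 < r₀) (hθ : 0 < θ)
    (hCL : 0 ≤ CL) (hLj : 0 < Lj) (hmain : cc * β * r₀ ^ 2 ≤ ℓ * D) (hD : D = 289 * (CL + 1) ^ 2 * Lj)
    (hβθ : β * θ ^ 2 = Lj * p ^ 2) (hp : 136 * (CL + 1) * Real.sqrt (ℓ / cc) ≤ p) : r₀ ≤ θ / 8 := by
  have hpos : 0 < cc * β * r₀ ^ 2 := by positivity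
  have hDpos : 0 < D := by rw [hD]; positivity
  have hℓ : 0 < ℓ := by
    by_contra hℓ
    push Not at hℓ
    have : ℓ * D ≤ 0 := mul_nonpos_of_nonpos_of_nonneg hℓ hDpos.le
    linarith
  have hsq : Real.sqrt (ℓ / cc) ^ 2 = ℓ / cc := Real.sq_sqrt (div_nonneg hℓ.le hcc.le)
  have hsqpos : 0 < Real.sqrt (ℓ / cc) := Real.sqrt_pos.mpr (div_pos hℓ hcc)
  have hp0 : 0 < p := lt_of_lt_of_le (by positivity) hp
  have hp2 : (136 * (CL + 1)) ^ 2 * (ℓ / cc) ≤ p ^ 2 := by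
    have h := pow_le_pow_left₀ (by positivity) hp 2
    rwa [mul_pow, hsq] at h
  -- `cc · p²` dominates `136² (CL+1)² ℓ`
  have hp2' : (136 * (CL + 1)) ^ 2 * ℓ ≤ cc * p ^ 2 := by
    have h := mul_le_mul_of_nonneg_left hp2 hcc.le
    have hcc0 : cc ≠ 0 := hcc.ne'
    calc (136 * (CL + 1)) ^ 2 * ℓ = cc * ((136 * (CL + 1)) ^ 2 * (ℓ / cc)) := by field_simp
      _ ≤ cc * p ^ 2 := h
  -- multiply the main inequality by `p²` and cancel `β`
  have hmain' : cc * r₀ ^ 2 * p ^ 2 ≤ 289 * (CL + 1) ^ 2 * θ ^ 2 * ℓ := by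
    have h := mul_le_mul_of_nonneg_right hmain (sq_nonneg p)
    have h' : ℓ * D * p ^ 2 = β * (289 * (CL + 1) ^ 2 * θ ^ 2 * ℓ) := by
      rw [hD]
      calc ℓ * (289 * (CL + 1) ^ 2 * Lj) * p ^ 2 = 289 * (CL + 1) ^ 2 * ℓ * (Lj * p ^ 2) := by ring
        _ = 289 * (CL + 1) ^ 2 * ℓ * (β * θ ^ 2) := by rw [hβθ]
        _ = β * (289 * (CL + 1) ^ 2 * θ ^ 2 * ℓ) := by ring
    rw [h'] at h
    have h'' : β * (cc * r₀ ^ 2 * p ^ 2) ≤ β * (289 * (CL + 1) ^ 2 * θ ^ 2 * ℓ) := by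
      calc β * (cc * r₀ ^ 2 * p ^ 2) = cc * β * r₀ ^ 2 * p ^ 2 := by ring
        _ ≤ _ := h
    exact le_of_mul_le_mul_left h'' hβ
  -- compare squares
  have hsq2 : (136 * r₀) ^ 2 * ((CL + 1) ^ 2 * ℓ) ≤ (17 * θ) ^ 2 * ((CL + 1) ^ 2 * ℓ) := by
    have h1 : (136 * r₀) ^ 2 * ((CL + 1) ^ 2 * ℓ) = r₀ ^ 2 * ((136 * (CL + 1)) ^ 2 * ℓ) := by ring
    have h2 : r₀ ^ 2 * ((136 * (CL + 1)) ^ 2 * ℓ) ≤ r₀ ^ 2 * (cc * p ^ 2) := mul_le_mul_of_nonneg_left hp2' (sq_nonneg r₀)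
    have h3 : r₀ ^ 2 * (cc * p ^ 2) = cc * r₀ ^ 2 * p ^ 2 := by ring
    have h4 : (17 * θ) ^ 2 * ((CL + 1) ^ 2 * ℓ) = 289 * (CL + 1) ^ 2 * θ ^ 2 * ℓ := by ring
    rw [h1, h4]
    exact (h2.trans_eq h3).trans hmain'
  have hw : 0 < (CL + 1) ^ 2 * ℓ := by positivity
  have hsq3 : (136 * r₀) ^ 2 ≤ (17 * θ) ^ 2 := le_of_mul_le_mul_right hsq2 hw
  have hlin : 136 * r₀ ≤ 17 * θ :=
    (pow_le_pow_iff_left₀ (by positivity) (by positivity) two_ne_zero).mp hsq3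
  linarith


-- hb: ONE declaration carrying `local_step`'s McShane ∕ box ∕ exponent body plus the median-centring block; measured from this seat:
-- fails at file-global `maxHeartbeats 100000`, passes at 150000 and at the default 200000 — the decl-local 400000 below is README-class
-- headroom against the CI heartbeat cliff (HOME/README.md RULES «HEARTBEAT BUDGET»), not a content need.
set_option maxHeartbeats 400000 in
/-- **THE ONE-HEIGHT STEP CENTRED AT THE MEDIAN** (LINE 27 (T), first lemma; statement = the ideator's handle verbatim).  As
`TwoSidedOfConcentration.local_step` with the mean face `E f_a ≤ θ/2` replaced by the 3/4-quantile `Gibbs_K{f_a ≤ θ/8} ≥ 3/4`, the rate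
positivity `0 < cc` and the smallness row `136(CL+1)·√(log(2Cc+2)/cc) ≤ p(g_{K−j})`: the capped McShane extension `g` has
`Gibbs_K{g ≤ θ/8} ≥ 1/2`, the concentration hypothesis for `−g` centres it (`E g ≤ θ/4`), and the concentration hypothesis for `g` at
`r = θ/4` bounds the local window event.  [cite: Balaban1985UV3, (3) p.256 and (7) p.257] -/
theorem local_step_median (F : T3Family) {γ b₀ p₀ : ℝ} (hγ : 0 < γ) (hγ2 : γ ≤ 1 / 2) (hb₀ : 0 < b₀)
    {K j : ℕ} (hjK : j + 2 ≤ K) (a : Plaq (F.P K) j) {Cc cc CL : ℝ} (hCL : 0 ≤ CL)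
    (hK1 : ∀ (n : ℕ), 1 ≤ n → (n : ℝ) ≤ (F.scheme ℰp γ).β K → 2 * n ≤ (F.P K).sitesPerDir 0 →
      ∀ (x₀ : Site (F.P K) 0) (f : GaugeField (F.P K) 0 (Matrix.specialUnitaryGroup (Fin 2) ℂ) → ℝ) (Λ : ℝ), 0 < Λ → Measurable f → GaugeField.GaugeInvariant f →
      (∀ U U' : GaugeField (F.P K) 0 (Matrix.specialUnitaryGroup (Fin 2) ℂ), (∀ b : PBond (F.P K) 0, (∀ k, (b.src k - x₀ k).val < n) → (∀ k, (b.tgt k - x₀ k).val < n) → U b = U' b) →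
        f U = f U') →
      (∀ U U' : GaugeField (F.P K) 0 (Matrix.specialUnitaryGroup (Fin 2) ℂ), |f U - f U'| ≤ Λ * Real.sqrt (∑ b : PBond (F.P K) 0, GaugeGroup.dist1 (U b * (U' b)⁻¹) ^ 2)) →
      ∀ r : ℝ, 0 ≤ r → (gibbsK F ℰp γ K).real {U | r ≤ f U - ∫ V, f V ∂(gibbsK F ℰp γ K)} ≤
        Cc * Real.exp (-(cc * (F.scheme ℰp γ).β K * r ^ 2 / ((n : ℝ) ^ 2 * Λ ^ 2))))
    (hK2 : ∀ U U' : GaugeField (F.P K) 0 (Matrix.specialUnitaryGroup (Fin 2) ℂ), (∀ (i : ℕ) (q : Plaq (F.P K) i), i < j → Site.tdist (fun k => ((((q.src k).val * F.L ^ i : ℕ)) : ZMod ((F.P K).sitesPerDir 0))) (fun k => ((((a.src k).val * F.L ^ j : ℕ)) : ZMod ((F.P K).sitesPerDir 0))) + 64 * F.L ^ i ≤ 64 * F.L ^ j → GaugeGroup.dist1 (GaugeField.plaqHol (Averaging.iter (fun i' => BlockAveraging.blockAvg (P := F.P K) (j := i') ℰp) i U) q) < θBal F.L γ b₀ p₀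 (K - i)) → (∀ (i : ℕ) (q : Plaq (F.P K) i), i < j → Site.tdist (fun k => ((((q.src k).val * F.L ^ i : ℕ)) : ZMod ((F.P K).sitesPerDir 0))) (fun k => ((((a.src k).val * F.L ^ j : ℕ)) : ZMod ((F.P K).sitesPerDir 0))) + 64 * F.L ^ i ≤ 64 * F.L ^ j → GaugeGroup.dist1 (GaugeField.plaqHol (Averaging.iter (fun i' => BlockAveraging.blockAvg (P := F.P K) (j := i') ℰp) i U') q) < θBal F.L γ b₀ p₀ (K - i)) →
      |GaugeGroup.dist1 (GaugeField.plaqHol (Averaging.iter (fun i' => BlockAveraging.blockAvg (P := F.P K) (j := i') ℰp) j U) a) - GaugeGroup.dist1 (GaugeField.plaqHol (Averaging.iter (fun i' => BlockAveraging.blockAvg (P := F.P K) (j := i') ℰp) j U') a)| ≤ CL / Real.sqrt ((F.L : ℝ) ^ j) * Real.sqrt (∑ b : PBond (F.P K) 0, if (∀ k, (b.src k - ((((a.src k).val * F.L ^ j : ℕ)) : ZMod ((F.P K).sitesPerDir 0)) + ((8 * F.L ^ j : ℕ) : ZMod ((F.P K).sitesPerDir 0))).val < 17 * F.L ^ j)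 ∧ (∀ k, (b.tgt k - ((((a.src k).val * F.L ^ j : ℕ)) : ZMod ((F.P K).sitesPerDir 0)) + ((8 * F.L ^ j : ℕ) : ZMod ((F.P K).sitesPerDir 0))).val < 17 * F.L ^ j) then GaugeGroup.dist1 (U b * (U' b)⁻¹) ^ 2 else 0))
    (hcc : 0 < cc)
    (hp : 136 * (CL + 1) * Real.sqrt (Real.log (2 * Cc + 2) / cc) ≤ B10.pFun b₀ p₀ (Real.sqrt (γ * ((F.L : ℝ)⁻¹) ^ (K - j))))
    (hMed : 3 / 4 ≤ (gibbsK F ℰp γ K).real {U : GaugeField (F.P K) 0 (Matrix.specialUnitaryGroup (Fin 2) ℂ) | GaugeGroup.dist1 (GaugeField.plaqHol (Averaging.iter (fun i' => BlockAveraging.blockAvg (P := F.P K) (j := i') ℰp) j U) a) ≤ θBal F.L γ b₀ p₀ (K - j) / 8})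
    (hGc : (gibbsK F ℰp γ K).real {U : GaugeField (F.P K) 0 (Matrix.specialUnitaryGroup (Fin 2) ℂ) | (∀ (i : ℕ) (q : Plaq (F.P K) i), i < j → Site.tdist (fun k => ((((q.src k).val * F.L ^ i : ℕ)) : ZMod ((F.P K).sitesPerDir 0))) (fun k => ((((a.src k).val * F.L ^ j : ℕ)) : ZMod ((F.P K).sitesPerDir 0))) + 64 * F.L ^ i ≤ 64 * F.L ^ j → GaugeGroup.dist1 (GaugeField.plaqHol (Averaging.iter (fun i' => BlockAveraging.blockAvg (P := F.P K) (j := i') ℰp) i U) q) < θBal F.L γ b₀ p₀ (K - i))}ᶜ ≤ 1 / 4) :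
    (gibbsK F ℰp γ K).real ({U : GaugeField (F.P K) 0 (Matrix.specialUnitaryGroup (Fin 2) ℂ) | θBal F.L γ b₀ p₀ (K - j) ≤ GaugeGroup.dist1 (GaugeField.plaqHol (Averaging.iter (fun i' => BlockAveraging.blockAvg (P := F.P K) (j := i') ℰp) j U) a)} ∩ {U : GaugeField (F.P K) 0 (Matrix.specialUnitaryGroup (Fin 2) ℂ) | (∀ (i : ℕ) (q : Plaq (F.P K) i), i < j → Site.tdist (fun k => ((((q.src k).val * F.L ^ i : ℕ)) : ZMod ((F.P K).sitesPerDir 0))) (fun k => ((((a.src k).val * F.L ^ j : ℕ)) : ZMod ((F.P K).sitesPerDir 0))) + 64 * F.L ^ i ≤ 64 * F.L ^ j → GaugeGroup.dist1 (GaugeField.plaqHol (Averaging.iter (fun i' => BlockAveraging.blockAvg (P := F.P K) (j := i') ℰp) i U) q) < θBal F.L γ b₀ p₀ (K - i))}) ≤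
      Cc * Real.exp (-(cc / (4624 * (CL + 1) ^ 2) * B10.pFun b₀ p₀ (Real.sqrt (γ * ((F.L : ℝ)⁻¹) ^ (K - j))) ^ 2))  := by

  haveI := isProbabilityMeasure_gibbsK F ℰp hγ.le K
  have hγ1 : γ ≤ 1 := by linarith
  have hL1 : 1 ≤ F.L := F.hL.2.le
  have hL3 : 3 ≤ F.L := by obtain ⟨k, hk⟩ := F.hL.1; have := F.hL.2; omega
  have hLr : (3 : ℝ) ≤ F.L := by exact_mod_cast hL3
  set μ := gibbsK F ℰp γ K with hμ
  set θ := θBal F.L γ b₀ p₀ (K - j) with hθ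
  have hθpos : 0 < θ := θBal_pos hL1 hγ hγ1 hb₀ p₀ (K - j)
  have hLj : (0 : ℝ) < (F.L : ℝ) ^ j := by positivity
  have hsq : 0 < Real.sqrt ((F.L : ℝ) ^ j) := Real.sqrt_pos.mpr hLj
  set Λ : ℝ := (CL + 1) / Real.sqrt ((F.L : ℝ) ^ j) with hΛ
  have hΛpos : 0 < Λ := div_pos (by linarith) hsq
  set f : GaugeField (F.P K) 0 (Matrix.specialUnitaryGroup (Fin 2) ℂ) → ℝ := fun U => GaugeGroup.dist1 (GaugeField.plaqHol (Averaging.iter (fun i' => BlockAveraging.blockAvg (P := F.P K) (j := i') ℰp) j U) a) with hf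
  set G : Set (GaugeField (F.P K) 0 (Matrix.specialUnitaryGroup (Fin 2) ℂ)) := {U : GaugeField (F.P K) 0 (Matrix.specialUnitaryGroup (Fin 2) ℂ) | (∀ (i : ℕ) (q : Plaq (F.P K) i), i < j → Site.tdist (fun k => ((((q.src k).val * F.L ^ i : ℕ)) : ZMod ((F.P K).sitesPerDir 0))) (fun k => ((((a.src k).val * F.L ^ j : ℕ)) : ZMod ((F.P K).sitesPerDir 0))) + 64 * F.L ^ i ≤ 64 * F.L ^ j → GaugeGroup.dist1 (GaugeField.plaqHol (Averaging.iter (fun i' => BlockAveraging.blockAvg (P := F.P K) (j := i') ℰp) i U) q) < θBal F.L γ b₀ p₀ (K - i))} with hG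
  set d : GaugeField (F.P K) 0 (Matrix.specialUnitaryGroup (Fin 2) ℂ) → GaugeField (F.P K) 0 (Matrix.specialUnitaryGroup (Fin 2) ℂ) → ℝ := fun U U' => Real.sqrt (∑ b : PBond (F.P K) 0, if (∀ k, (b.src k - ((((a.src k).val * F.L ^ j : ℕ)) : ZMod ((F.P K).sitesPerDir 0)) + ((8 * F.L ^ j : ℕ) : ZMod ((F.P K).sitesPerDir 0))).val < 17 * F.L ^ j) ∧ (∀ k, (b.tgt k - ((((a.src k).val * F.L ^ j : ℕ)) : ZMod ((F.P K).sitesPerDir 0)) + ((8 * F.L ^ j : ℕ) : ZMod ((F.P K).sitesPerDir 0))).val < 17 * F.L ^ j) then GaugeGroup.dist1 (U b * (U' b)⁻¹) ^ 2 else 0) with hd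
  -- §1 the McShane extension
  obtain ⟨g, hg0, hgθ, hgf, hgeq, hgLip, hginv, hgloc, hgmeas⟩ :=
    exists_capped_infConvolution d (fun U U' => boxLinkDist_nonneg _ U U') (fun U => boxLinkDist_self _ U)
      (fun U U' => boxLinkDist_comm _ U U') (fun U U' U'' => boxLinkDist_triangle _ U U' U'')
      (fun U' => continuous_boxLinkDist _ U') G f (fun U => GaugeGroup.dist1_nonneg _) θ Λ hθpos.le hΛpos.le
      (fun U hU U' hU' => (hK2 U U' hU hU').trans
        (mul_le_mul_of_nonneg_right (div_le_div_of_nonneg_right (by linarith) hsq.le) (Real.sqrt_nonneg _)))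
      (GaugeField.gaugeAct (P := F.P K) (j := 0) (G := (Matrix.specialUnitaryGroup (Fin 2) ℂ)))
      (fun u U hU => by
        simp only [hG, Set.mem_setOf_eq] at hU ⊢
        intro i q hi hnear
        rw [dist1_plaqHol_iter_gaugeAct F (by omega) q u U]
        exact hU i q hi hnear)
      (fun u U => by simp only [hf]; exact dist1_plaqHol_iter_gaugeAct F (by omega) a u U)
      (fun u U U' => boxLinkDist_gaugeAct _ u U U')
      (fun u => ⟨fun x => (u x)⁻¹, gaugeAct_gaugeAct_inv u⟩)
      (fun U U' => ∀ b : PBond (F.P K) 0, (∀ k, (b.src k - ((((a.src k).val * F.L ^ j : ℕ)) : ZMod ((F.P K).sitesPerDir 0)) + ((8 * F.L ^ j : ℕ) : ZMod ((F.P K).sitesPerDir 0))).val < 17 * F.L ^ j) ∧ (∀ k, (b.tgt k - ((((a.src k).val * F.L ^ j : ℕ)) : ZMod ((F.P K).sitesPerDir 0)) + ((8 * F.L ^ j : ℕ) : ZMod ((F.P K).sitesPerDir 0))).val < 17 * F.L ^ j) → U b = U' b)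
      (fun U U' h V => boxLinkDist_congr_left _ h V)
  -- §2 measurability and integrability
  have hmeas : ∀ (i : ℕ) (q : Plaq (F.P K) i), Measurable fun U : GaugeField (F.P K) 0 (Matrix.specialUnitaryGroup (Fin 2) ℂ) =>
      GaugeGroup.dist1 (GaugeField.plaqHol (Averaging.iter (fun i' => BlockAveraging.blockAvg (P := F.P K) (j := i') ℰp) i U) q) :=
    fun i q => RegularGaugeGroup.measurable_dist1.comp ((Missing.measurable_plaqHol q).comp
      (T4Continuum.measurable_iter _ (F.avgMeasurable_of_measurableE ℰp measurableE_ℰp K) i))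
  have hf_meas : Measurable f := hmeas j a
  have hf_int : Integrable f μ :=
    Integrable.mono' (integrable_const (2 : ℝ)) hf_meas.aestronglyMeasurable
      (ae_of_all _ fun U => by
        rw [Real.norm_eq_abs, abs_of_nonneg (GaugeGroup.dist1_nonneg _)]
        exact dist1_le_two_specialUnitaryGroup _)
  have hg_int : Integrable g μ :=
    Integrable.mono' (integrable_const θ) hgmeas.aestronglyMeasurable
      (ae_of_all _ fun U => by rw [Real.norm_eq_abs, abs_of_nonneg (hg0 U)]; exact hgθ U)
  have hG_meas : MeasurableSet G := by
    have hGeq : G = ⋂ (i : ℕ), ⋂ (q : Plaq (F.P K) i),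
        {U : GaugeField (F.P K) 0 (Matrix.specialUnitaryGroup (Fin 2) ℂ) | i < j → Site.tdist (fun k => ((((q.src k).val * F.L ^ i : ℕ)) : ZMod ((F.P K).sitesPerDir 0))) (fun k => ((((a.src k).val * F.L ^ j : ℕ)) : ZMod ((F.P K).sitesPerDir 0))) + 64 * F.L ^ i ≤ 64 * F.L ^ j → GaugeGroup.dist1 (GaugeField.plaqHol (Averaging.iter (fun i' => BlockAveraging.blockAvg (P := F.P K) (j := i') ℰp) i U) q) < θBal F.L γ b₀ p₀ (K - i)} := by
      ext U
      simp only [hG, Set.mem_setOf_eq, Set.mem_iInter]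
    rw [hGeq]
    refine MeasurableSet.iInter fun i => MeasurableSet.iInter fun q => ?_
    by_cases hc : i < j ∧ Site.tdist (fun k => ((((q.src k).val * F.L ^ i : ℕ)) : ZMod ((F.P K).sitesPerDir 0))) (fun k => ((((a.src k).val * F.L ^ j : ℕ)) : ZMod ((F.P K).sitesPerDir 0))) + 64 * F.L ^ i ≤ 64 * F.L ^ j
    · have hset : {U : GaugeField (F.P K) 0 (Matrix.specialUnitaryGroup (Fin 2) ℂ) | i < j → Site.tdist (fun k => ((((q.src k).val * F.L ^ i : ℕ)) : ZMod ((F.P K).sitesPerDir 0))) (fun k => ((((a.src k).val * F.L ^ j : ℕ)) : ZMod ((F.P K).sitesPerDir 0))) + 64 * F.L ^ i ≤ 64 * F.L ^ j → GaugeGroup.dist1 (GaugeField.plaqHol (Averaging.iter (fun i' => BlockAveraging.blockAvg (P := F.P K) (j := i') ℰp) i U) q) < θBal F.L γ b₀ p₀ (K - i)} =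
          {U : GaugeField (F.P K) 0 (Matrix.specialUnitaryGroup (Fin 2) ℂ) | GaugeGroup.dist1 (GaugeField.plaqHol (Averaging.iter (fun i' => BlockAveraging.blockAvg (P := F.P K) (j := i') ℰp) i U) q) < θBal F.L γ b₀ p₀ (K - i)} := by
        ext U
        simp only [Set.mem_setOf_eq]
        exact ⟨fun h => h hc.1 hc.2, fun h _ _ => h⟩
      rw [hset]
      exact measurableSet_lt (hmeas i q) measurable_const
    · have hset : {U : GaugeField (F.P K) 0 (Matrix.specialUnitaryGroup (Fin 2) ℂ) | i < j → Site.tdist (fun k => ((((q.src k).val * F.L ^ i : ℕ)) : ZMod ((F.P K).sitesPerDir 0))) (fun k => ((((a.src k).val * F.L ^ j : ℕ)) : ZMod ((F.P K).sitesPerDir 0))) + 64 * F.L ^ i ≤ 64 * F.L ^ j → GaugeGroup.dist1 (GaugeField.plaqHol (Averaging.iter (fun i' => BlockAveraging.blockAvg (P := F.P K) (j := i') ℰp) i U) q) < θBal F.L γ b₀ p₀ (K - i)} = Set.univ := by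
        ext U
        simp only [Set.mem_setOf_eq, Set.mem_univ, iff_true]
        intro h1 h2
        exact absurd ⟨h1, h2⟩ hc
      rw [hset]
      exact MeasurableSet.univ
  -- §3 the box: side `n = 17 L^j`, corner `corner(a) L^j − 8 L^j`
  have h1n : 1 ≤ 17 * F.L ^ j := by
    have : 1 ≤ F.L ^ j := Nat.one_le_pow _ _ (by omega)
    omega
  have h2n : 2 * (17 * F.L ^ j) ≤ (F.P K).sitesPerDir 0 := by
    have hN0 : (F.P K).sitesPerDir 0 = 2 * F.L ^ (F.m + K) := by simp [Params.sitesPerDir]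
    rw [hN0]
    have hsplit : F.L ^ (F.m + K) = F.L ^ j * F.L ^ (F.m + K - j) := by rw [← pow_add]; congr 1; omega
    have h27 : 27 ≤ F.L ^ (F.m + K - j) :=
      calc 27 = 3 ^ 3 := by norm_num
        _ ≤ F.L ^ 3 := Nat.pow_le_pow_left hL3 3
        _ ≤ F.L ^ (F.m + K - j) := Nat.pow_le_pow_right (by omega) (by have := F.hm; omega)
    rw [hsplit]
    nlinarith
  have hβK : (F.scheme ℰp γ).β K = (F.L : ℝ) ^ K / γ := by
    show (γ * (F.P K).eps)⁻¹ = _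
    have heps : (F.P K).eps = ((F.L : ℝ)⁻¹) ^ K := rfl
    rw [heps, mul_inv, inv_pow, inv_inv, div_eq_inv_mul]
  have hnβ : ((17 * F.L ^ j : ℕ) : ℝ) ≤ (F.scheme ℰp γ).β K := by
    rw [hβK, le_div_iff₀ hγ]
    push_cast
    have hsplit : (F.L : ℝ) ^ K = (F.L : ℝ) ^ j * (F.L : ℝ) ^ (K - j) := by rw [← pow_add]; congr 1; omega
    have h9 : (9 : ℝ) ≤ (F.L : ℝ) ^ (K - j) :=
      calc (9 : ℝ) = 3 ^ 2 := by norm_num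
        _ ≤ (F.L : ℝ) ^ 2 := pow_le_pow_left₀ (by norm_num) hLr 2
        _ ≤ (F.L : ℝ) ^ (K - j) := pow_le_pow_right₀ (by linarith) (by omega)
    rw [hsplit]
    nlinarith
  set x₀ : Site (F.P K) 0 := fun k => ((((a.src k).val * F.L ^ j : ℕ)) : ZMod ((F.P K).sitesPerDir 0)) - ((8 * F.L ^ j : ℕ) : ZMod ((F.P K).sitesPerDir 0)) with hx₀
  have hbox : ∀ U U' : GaugeField (F.P K) 0 (Matrix.specialUnitaryGroup (Fin 2) ℂ), (∀ b : PBond (F.P K) 0, (∀ k, (b.src k - x₀ k).val < 17 * F.L ^ j) →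
      (∀ k, (b.tgt k - x₀ k).val < 17 * F.L ^ j) → U b = U' b) → g U = g U' := by
    intro U U' h
    refine hgloc U U' fun b hb => h b (fun k => ?_) (fun k => ?_)
    · have hk : b.src k - x₀ k = b.src k - ((((a.src k).val * F.L ^ j : ℕ)) : ZMod ((F.P K).sitesPerDir 0)) + ((8 * F.L ^ j : ℕ) : ZMod ((F.P K).sitesPerDir 0)) := by
        simp only [hx₀]; ring
      rw [hk]; exact hb.1 k
    · have hk : b.tgt k - x₀ k = b.tgt k - ((((a.src k).val * F.L ^ j : ℕ)) : ZMod ((F.P K).sitesPerDir 0)) + ((8 * F.L ^ j : ℕ) : ZMod ((F.P K).sitesPerDir 0)) := by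
        simp only [hx₀]; ring
      rw [hk]; exact hb.2 k
  have hLipg : ∀ U U' : GaugeField (F.P K) 0 (Matrix.specialUnitaryGroup (Fin 2) ℂ), |g U - g U'| ≤
      Λ * Real.sqrt (∑ b : PBond (F.P K) 0, GaugeGroup.dist1 (U b * (U' b)⁻¹) ^ 2) :=
    fun U U' => (hgLip U U').trans (mul_le_mul_of_nonneg_left (boxLinkDist_le_linkDist _ U U') hΛpos.le)
  -- §4 exponent identities
  have hKsplit : K - j + j = K := Nat.sub_add_cancel (by omega)
  have hβLj : (F.scheme ℰp γ).β K = (F.L : ℝ) ^ j * (F.scheme ℰp γ).β (K - j) := by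
    show (γ * (F.P K).eps)⁻¹ = (F.L : ℝ) ^ j * (γ * (F.P (K - j)).eps)⁻¹
    have he1 : (F.P K).eps = ((F.L : ℝ)⁻¹) ^ K := rfl
    have he2 : (F.P (K - j)).eps = ((F.L : ℝ)⁻¹) ^ (K - j) := rfl
    have hL0 : (F.L : ℝ) ≠ 0 := by positivity
    rw [he1, he2]
    conv_lhs => rw [← hKsplit]
    rw [pow_add, inv_pow, inv_pow]
    field_simp
  have hβθ : (F.scheme ℰp γ).β K * θ ^ 2 =
      (F.L : ℝ) ^ j * B10.pFun b₀ p₀ (Real.sqrt (γ * ((F.L : ℝ)⁻¹) ^ (K - j))) ^ 2 := by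
    rw [hβLj, mul_assoc, beta_mul_θBal_sq F hγ b₀ p₀ (K - j)]
  have hnΛ : (((17 * F.L ^ j : ℕ)) : ℝ) ^ 2 * Λ ^ 2 = 289 * (CL + 1) ^ 2 * (F.L : ℝ) ^ j := by
    rw [hΛ, div_pow, Real.sq_sqrt hLj.le]
    push_cast
    field_simp
    ring

  -- §5 THE MEDIAN CENTRING: `Gibbs_K{g ≤ θ/8} ≥ 1/2`, then K1 for `−g` forces `E g ≤ θ/4`
  have hβpos : 0 < (F.scheme ℰp γ).β K := by rw [hβK]; positivity
  have hnΛpos : 0 < (((17 * F.L ^ j : ℕ)) : ℝ) ^ 2 * Λ ^ 2 := by rw [hnΛ]; positivity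
  have hhalf : 1 / 2 ≤ μ.real {U | g U ≤ θ / 8} := by
    have hcover : {U : GaugeField (F.P K) 0 (Matrix.specialUnitaryGroup (Fin 2) ℂ) | f U ≤ θ / 8} ⊆ {U | g U ≤ θ / 8} ∪ Gᶜ := by
      intro U hU
      by_cases hUG : U ∈ G
      · exact Or.inl (le_trans (hgf U hUG) hU)
      · exact Or.inr hUG
    have h1 : μ.real {U : GaugeField (F.P K) 0 (Matrix.specialUnitaryGroup (Fin 2) ℂ) | f U ≤ θ / 8} ≤ μ.real {U | g U ≤ θ / 8} + μ.real Gᶜ :=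
      (measureReal_mono hcover (measure_ne_top _ _)).trans (measureReal_union_le _ _)
    have h2 : 3 / 4 ≤ μ.real {U : GaugeField (F.P K) 0 (Matrix.specialUnitaryGroup (Fin 2) ℂ) | f U ≤ θ / 8} := hMed
    linarith
  have hint_g : ∫ U, g U ∂μ ≤ θ / 4 := by
    by_cases hr : ∫ U, g U ∂μ ≤ θ / 8
    · linarith
    push Not at hr
    obtain ⟨r₀, hr₀⟩ : ∃ r₀ : ℝ, r₀ = ∫ U, g U ∂μ - θ / 8 := ⟨_, rfl⟩
    have hr₀pos : 0 < r₀ := by rw [hr₀]; linarith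
    -- K1 for the admissible observable `−g` at radius `r₀`
    have hKm : μ.real {U | r₀ ≤ -g U - ∫ V, -g V ∂μ} ≤
        Cc * Real.exp (-(cc * (F.scheme ℰp γ).β K * r₀ ^ 2 / ((((17 * F.L ^ j : ℕ)) : ℝ) ^ 2 * Λ ^ 2))) :=
      hK1 (17 * F.L ^ j) h1n hnβ h2n x₀ (fun U => -g U) Λ hΛpos hgmeas.neg
        (fun u U => by show -g (GaugeField.gaugeAct u U) = -g U; rw [hginv u U])
        (fun U U' h => by show -g U = -g U'; rw [hbox U U' h])
        (fun U U' => by show |-g U - -g U'| ≤ _; rw [neg_sub_neg, abs_sub_comm]; exact hLipg U U')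
        r₀ hr₀pos.le
    have hev : {U : GaugeField (F.P K) 0 (Matrix.specialUnitaryGroup (Fin 2) ℂ) | g U ≤ θ / 8} ⊆ {U | r₀ ≤ -g U - ∫ V, -g V ∂μ} := by
      intro U hU
      simp only [Set.mem_setOf_eq] at hU ⊢
      rw [integral_neg, hr₀]
      linarith
    have hX : 1 / 2 ≤ Cc * Real.exp (-(cc * (F.scheme ℰp γ).β K * r₀ ^ 2 / ((((17 * F.L ^ j : ℕ)) : ℝ) ^ 2 * Λ ^ 2))) :=
      hhalf.trans ((measureReal_mono hev (measure_ne_top _ _)).trans hKm)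
    have hA := exponent_le_log_of_half_le (div_nonneg (by positivity) hnΛpos.le) hX
    rw [div_le_iff₀ hnΛpos] at hA
    have hB := centring_radius_le hcc hβpos hr₀pos hθpos hCL hLj hA hnΛ hβθ hp
    rw [hr₀] at hB
    linarith
  -- §6 the event sits in the upper tail of `g`
  have hsub : ({U : GaugeField (F.P K) 0 (Matrix.specialUnitaryGroup (Fin 2) ℂ) | θ ≤ f U} ∩ G) ⊆ {U | θ / 4 ≤ g U - ∫ V, g V ∂μ} := by
    rintro U ⟨hU1, hU2⟩
    simp only [Set.mem_setOf_eq] at hU1 ⊢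
    rw [hgeq U hU2 hU1]
    linarith

  -- §7 concentration for `g` at `r = θ/4` and the exponent bookkeeping
  have hK := hK1 (17 * F.L ^ j) h1n hnβ h2n x₀ g Λ hΛpos hgmeas hginv hbox hLipg (θ / 4) (by positivity)
  have hexp : cc * (F.scheme ℰp γ).β K * (θ / 4) ^ 2 / ((((17 * F.L ^ j : ℕ)) : ℝ) ^ 2 * Λ ^ 2) =
      cc / (4624 * (CL + 1) ^ 2) * B10.pFun b₀ p₀ (Real.sqrt (γ * ((F.L : ℝ)⁻¹) ^ (K - j))) ^ 2 := by
    have h1 : cc * (F.scheme ℰp γ).β K * (θ / 4) ^ 2 = cc * ((F.scheme ℰp γ).β K * θ ^ 2) / 16 := by ring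
    rw [h1, hβθ, hnΛ]
    have hCL1 : (CL + 1) ≠ 0 := by linarith
    field_simp
    ring
  -- §8 conclude
  calc μ.real ({U : GaugeField (F.P K) 0 (Matrix.specialUnitaryGroup (Fin 2) ℂ) | θ ≤ f U} ∩ G)
      ≤ μ.real {U | θ / 4 ≤ g U - ∫ V, g V ∂μ} := measureReal_mono hsub (measure_ne_top _ _)
    _ ≤ Cc * Real.exp (-(cc * (F.scheme ℰp γ).β K * (θ / 4) ^ 2 / ((((17 * F.L ^ j : ℕ)) : ℝ) ^ 2 * Λ ^ 2))) := hK
    _ = Cc * Real.exp (-(cc / (4624 * (CL + 1) ^ 2) * B10.pFun b₀ p₀ (Real.sqrt (γ * ((F.L : ℝ)⁻¹) ^ (K - j))) ^ 2)) := by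
        rw [hexp]

end Summit.QuantumFields.YangMills.Theorems.PoincareLipschitz.MedianCentring
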